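import Mathlib
import Summits.NavierStokesRegularity.OSWSelfSimilar.TypeIIModulatedWeights
import HarnessLib
/-!
# The swirl bound survives the blow-up limit (zone Z1 TEMPLATE §T1.4-I (I-2), last sentence, and the class hypothesis
# of (I-4)(β)/(I-5) — kernel-checked)

HONEST FRAMING (cell ns-blowup GROUP B «PROFILE SEARCH», zone Z1 «Type-II log-modulated DSS ansatz for axisymmetric
Navier–Stokes — the template IS the deliverable»; D-0035/D-0074): part XI of the Z1 dictionary. TEMPLATE (I-2):
«Swirl: `G⁽ⁿ⁾(y, s) = Γ(x, t)` ⇒ `|G_W| ≤ ‖Γ₀‖_∞` (bounded swirl survives the limit)» — the sentence that places the inner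
object `W` of (I-4)(β) inside the bounded-swirl class of the OPEN Liouville problem
`Summit.NavierStokesRegularity.NavierStokesRegularity.AxisymmetricLiouvilleBoundedSwirl` (hypothesis
`∃ C, ∀ t < 0, ∀ x, |swirl (u t) x| ≤ C`). Part V made the first half kernel (`swirl_smul_comp_axisAffine`: the
rescaled swirl IS the physical swirl for axis-centred rescalings; `abs_swirl_modulatedProfile_le`: hence `≤ ‖Γ₀‖_∞` in
every gauge, from the tree's DISCHARGED `Literature.Analysis.FluidPDE.abs_swirl_le_of_classical`). This file adds the
passage to the limit:

* `abs_swirl_le_of_tendsto` — the swirl bound is closed under pointwise convergence of the fields at a point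
  (`swirl V y = y₀V₁(y) − y₁V₀(y)` is continuous in the value `V(y)`);
* `abs_swirl_rescaled_le` — every member of an axis-centred rescaled family
  `V_n(y) = λ_n • v(t_n, x*_n + λ_n • y)` (`t_n ∈ [0, T]`, `x*_n` on the axis, any `λ_n`) of a classical axisymmetric
  solution with `|Γ₀| ≤ M` has `|swirl V_n (y)| ≤ M` (part V, per slice);
* `abs_swirl_limit_le` — **hence every pointwise limit `W` of such a family has `|swirl W y| ≤ M` for all `y`**: the
  inner object inherits the swirl bound `‖Γ₀‖_∞`, slice by slice (for an ancient limit `W(s, ·)` apply it with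
  `t_n(s) = t_n + λ_n² s`).

**Nothing here asserts that a blow-up, a rescaled family with a non-trivial limit, or a Liouville counterexample exists**:
IF a pointwise limit exists, it obeys the bound. «violates: n/a — dictionary»; bears_on LADDER-NS N5/Z1 → N1 linear core /
N0⁻. Author: ns-blowup-profile-eng-1 g5, 2026-08-27.
-/

open Real Filter Topology Set
open Literature.Analysis.FluidPDE

namespace Summit.NavierStokesRegularity.OSWSelfSimilar
namespace TypeIIModulationDictionary

/-- **The swirl bound is closed under pointwise limits.** If `V_n(y) → W(y)` and `|swirl V_n (y)| ≤ M` for all `n`, then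
`|swirl W (y)| ≤ M` (the swirl at `y` is a continuous function of the value at `y`). [new here — dictionary] -/
theorem abs_swirl_le_of_tendsto {V : ℕ → EuclideanSpace ℝ (Fin 3) → EuclideanSpace ℝ (Fin 3)}
    {W : EuclideanSpace ℝ (Fin 3) → EuclideanSpace ℝ (Fin 3)} {M : ℝ} {y : EuclideanSpace ℝ (Fin 3)}
    (hlim : Tendsto (fun n => V n y) atTop (𝓝 (W y))) (hb : ∀ n, |swirl (V n) y| ≤ M) : |swirl W y| ≤ M := by
  -- the swirl at `y` as a continuous function of the value `V(y)`
  have hcont : Continuous fun v : EuclideanSpace ℝ (Fin 3) => |y 0 * v 1 - y 1 * v 0| := by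
    fun_prop
  have hconv : Tendsto (fun n => |swirl (V n) y|) atTop (𝓝 |swirl W y|) := by
    have h := (hcont.tendsto (W y)).comp hlim
    simpa [swirl, Function.comp_def] using h
  exact le_of_tendsto' hconv hb

section Limit

variable {T ν V₀ M : ℝ} {v : ℝ → EuclideanSpace ℝ (Fin 3) → EuclideanSpace ℝ (Fin 3)}
  {q : ℝ → EuclideanSpace ℝ (Fin 3) → ℝ}

/-- **Every member of an axis-centred rescaled family obeys the swirl bound** (part V `abs_swirl_modulatedProfile_le`,
per slice): under the hypotheses of `Literature.Analysis.FluidPDE.abs_swirl_le_of_classical` (classical unforced NS on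
`[0, T] × ℝ³`, `ν > 0`, bounded axisymmetric velocity, `|Γ₀| ≤ M`), for times `t_n ∈ [0, T]`, centres `x*_n` on the axis
and any scales `λ_n`, `|swirl (λ_n • v(t_n, x*_n + λ_n •)) (y)| ≤ M`. [new here — dictionary] -/
theorem abs_swirl_rescaled_le (hν : 0 < ν) (hT : 0 < T) (hcl : IsClassicalNSSolutionOn (Icc 0 T) ν 0 v q)
    (haxi : ∀ t ∈ Icc 0 T, IsAxisymmetric (v t)) (hV : ∀ t ∈ Icc 0 T, ∀ x, ‖v t x‖ ≤ V₀)
    (hM : ∀ x, |swirl (v 0) x| ≤ M) {tn lamn : ℕ → ℝ} {xcn : ℕ → EuclideanSpace ℝ (Fin 3)}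
    (htn : ∀ n, tn n ∈ Icc 0 T) (hxc : ∀ n, xcn n 0 = 0 ∧ xcn n 1 = 0) (n : ℕ) (y : EuclideanSpace ℝ (Fin 3)) :
    |swirl (fun w => lamn n • v (tn n) (xcn n + lamn n • w)) y| ≤ M :=
  abs_swirl_modulatedProfile_le hν hT hcl haxi hV hM (htn n) (lamn n) (hxc n).1 (hxc n).2 y

/-- **TEMPLATE (I-2): the swirl bound survives the blow-up limit.** Under the hypotheses of `abs_swirl_rescaled_le`, if
the axis-centred rescaled family `V_n(y) = λ_n • v(t_n, x*_n + λ_n • y)` converges pointwise to `W`, then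
`|swirl W (y)| ≤ M` for every `y` — the inner object carries swirl at most `‖Γ₀‖_∞`, the class hypothesis of (I-4)(β) /
`AxisymmetricLiouvilleBoundedSwirl` (slice by slice). [new here — dictionary] -/
theorem abs_swirl_limit_le (hν : 0 < ν) (hT : 0 < T) (hcl : IsClassicalNSSolutionOn (Icc 0 T) ν 0 v q)
    (haxi : ∀ t ∈ Icc 0 T, IsAxisymmetric (v t)) (hV : ∀ t ∈ Icc 0 T, ∀ x, ‖v t x‖ ≤ V₀)
    (hM : ∀ x, |swirl (v 0) x| ≤ M) {tn lamn : ℕ → ℝ} {xcn : ℕ → EuclideanSpace ℝ (Fin 3)}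
    (htn : ∀ n, tn n ∈ Icc 0 T) (hxc : ∀ n, xcn n 0 = 0 ∧ xcn n 1 = 0)
    {W : EuclideanSpace ℝ (Fin 3) → EuclideanSpace ℝ (Fin 3)}
    (hlim : ∀ y, Tendsto (fun n => lamn n • v (tn n) (xcn n + lamn n • y)) atTop (𝓝 (W y))) (y : EuclideanSpace ℝ (Fin 3)) :
    |swirl W y| ≤ M :=
  abs_swirl_le_of_tendsto (V := fun n w => lamn n • v (tn n) (xcn n + lamn n • w)) (hlim y)
    (fun n => abs_swirl_rescaled_le hν hT hcl haxi hV hM htn hxc n y)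

end Limit

end TypeIIModulationDictionary
end Summit.NavierStokesRegularity.OSWSelfSimilar
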